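import Summits.QuantumFields.YangMills.Theorems.BalabanUVNodesN20QuantisedRatioNoRescueAtRecord
import Summits.QuantumFields.YangMills.Theorems.BalabanUVNodesK3V5Defs

/-!
# BalabanUVNodes ∕ N20·N19′ — NO DIAL RESCUES THE CORE EDGE, AT THE v5 STUB TEXTS BY NAME (`Thm/BalabanUVNodesK3V5Defs`, p606160): for a witness `(jc, sh, cr)` with
# `PinnedAtLive jc sh cr`, the three faces `KeyedRelWeight cr ∧ KeyedShellWeight cr ∧ KeyedCoreEdgeHolderD4 β cr rr` of `stub_expansion13H`'s conclusion CANNOT hold if at ONE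
# live guarded admissible Stage-13 tuple `(F, θ, hP)` at which (B) and the UV endpoint hold, the rows (Q) ∧ (ACn) of `…N20QuantisedRatioNoRescue` at dag-n20-d's reading of
# record are NOT EXCLUDED BY THE RATES IN THE TUNING WINDOW — `¬ ForSmallCouplings D (g₀ ↦ ∀ os, PHolderD4 β D (rr F θ hP g₀ os) → ¬ Rows g₀ os)`

Cell `pub-ymgap`, YM-PLAN Track A (HUMAN RULING D-0062; D-0149 ∕ D-0154, director-ym R399 (3a)); width seat `pub-ymgap-dag-n20-w5` (g0) on node N20 = NE7b; key item K3⁷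
`SpineGivenEndpointR13SepCoPH` = stmt-QuantumFields-20544 (`--kind proof --supports 20544 --as helper`); COUNT-NEUTRAL.  Third file of the seat's piece (bus CLAIM-1 ∕ INTENT-1∕2∕3,
pub-ymgap INBOX l.29068 ∕ l.29325): `…N20QuantisedRatioNoRescue` (p606977; the [folklore] mechanism) → `…N20QuantisedRatioNoRescueAtRecord` (at `crOfRecord₁₃VAt`) → THIS (at the
registered texts of K3⁷ v5 941dddb108cbaacf through dag-n27-w1's by-name mirror `K3V5Defs`).

WHAT IT SAYS.  CRIT-1's triage of the crux card `window-key-core` (pub-ymgap INBOX l.28908) books the card's «stub 2 refutable at its pin» as a CONDITIONAL DIAGNOSIS: (SAT) ∧ (XG) ∧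
«shells not closed».  With the shells ∕ booking ∕ rate dials closed by p606977 (all universal), the diagnosis takes the following KERNEL FORM at the v5 texts: fix an exponent `β`,
a rate reading `rr`, and ANY witness triple `(jc, sh, cr)` pinned on the live line (`PinnedAtLive jc sh cr`, v5 :363).  Suppose SOME tuple `(F, θ, hP)` passes the guard
`ZhUnity ∧ SlotsNondegenerate₁₃`, is `Admissible`, carries statement (B) and the UV endpoint at its datum of record, lies on the live-selector line (`LiveSel F θ`), and there the
rows (Q) ∧ (ACn) — a D-quantised two-run log-ratio of `weightB₁₃ ∕ weightA₁₃` along an integer key label, anti-concentrated under `weightA₁₃`, frequently in `K` at some source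
`|t| ≤ 1` — are NOT excluded by the rates inside [Balaban1987RG1] Thm 2's tuning window: `¬ ForSmallCouplings D (fun g₀ => ∀ os, PHolderD4 β D (rr F θ hP g₀ os) → ¬ Rows g₀ os)`
(equivalently: cofinally in the window some tuned `g₀` and some `os` carry the rates `PHolderD4` TOGETHER WITH the rows — so the hypothesis also carries the window's
inhabitation and stub 1's rates at that tuple, all DISPLAYED, none decided).  THEN `¬ (KeyedRelWeight cr ∧ KeyedShellWeight cr ∧ KeyedCoreEdgeHolderD4 β cr rr)` — the N20, N21
and N19′ faces of `stub_expansion13H`'s body fail for THIS witness, whatever `jc` and `sh` are.  Proof: the N19′ face is `ForSmallCouplings D (g₀ ↦ ∀ os, PHolderD4 → ∃ δ, Core …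
∧ Summable δ)` at that tuple; by `ForSmallCouplings.mono` and the companion's `not_faces_crOfRecord₁₃VAt_of_quantised_antiConc` (the reading at `(g₀, os)` IS
`crOfRecord₁₃VAt 0 (jc F θ hP g₀ os) sh F θ hP g₀ os` by the pin), the N20 ∕ N21 faces at `(g₀, os)` and the core edge EXCLUDE the rows — contradicting the hypothesis.

HONEST FRAMING.  A CONDITIONAL DIAGNOSIS in kernel form, NOT a refutation: the hypothesis bundles (i) a live guarded admissible tuple with (B) + endpoint (K0⁷-type content,
OPEN), (ii) the R-β rates `PHolderD4` at tuned couplings there (stub-1 content, OPEN), (iii) the rows (Q) ∧ (ACn) at the record ((XG) = def-T-kernel analytic content and the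
(SAT) mechanism — NOT decided, NOT asserted for Bałaban's objects).  Nothing of Bałaban's asserted; proves NO estimate; refutes NO registered stub; NE7 ∕ NE7b ∕ NE7c NOT PRINTED
for d = 4 ∕ NOT proved; N19 ∕ N20 ∕ N21 NOT discharged; K3⁷ OPEN; counts UNMOVED (typed 28∕28 · discharged 5∕27, A 5∕28); no count claim; no summit statement is proved by this
seat; one finite 𝕋⁴ programme at fixed ε, Bałaban AS PRINTED — R4 closes the conditional rung `BalabanLadder.UV` only; the YM mass gap (Clay) is NOT proved by any of this;
NOT ℝ⁴, NOT OS.  No `def`, no `instance`, no `notation`, no `sorry`; no decl carries a cite tag.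
-/

noncomputable section

open Finset Real
open _root_.Filter _root_.Topology

namespace Summit.QuantumFields.YangMills.BalabanUVNodes.N20QuantisedRatioNoRescueStubText

open Literature.MathematicalPhysics.QuantumFieldTheory.Balaban1983to89
open Literature.MathematicalPhysics.QuantumFieldTheory.Balaban1983to89.T4Continuum
open Literature.MathematicalPhysics.QuantumFieldTheory.Balaban1983to89.Node00
open T4ContinuumYM4Torus (ForSmallCouplings)
open YMDAG.UVSplit
open Summit.QuantumFields.YangMills.Theorems.K3V5Defs
open Summit.QuantumFields.YangMills.BalabanUVNodes.N20QuantisedRatioNoRescueAtRecord (not_faces_crOfRecord₁₃VAt_of_quantised_antiConc)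

/-- ★★ **THE CONDITIONAL DIAGNOSIS AT THE v5 TEXTS** [bookkeeping]: a witness `(jc, sh, cr)` pinned on the live line cannot carry the N20 ∧ N21 ∧ N19′ faces of
`stub_expansion13H`'s conclusion if at one live guarded admissible tuple with (B) and the endpoint the rows (Q) ∧ (ACn) at the reading of record are not excluded by the rates
in the tuning window.  Every antecedent DISPLAYED; nothing decided. -/
theorem not_keyedFaces_of_pinnedAtLive_of_rows (β : ℝ) (rr : RateReadingFn) (jc : CutReading) (sh : ShellSplit₁₃CoPH 2 0) (cr : SpineReading)
    (hpin : PinnedAtLive jc sh cr) {F : T4Family} (θ : Stage13HParams F 2) (hP : θ.Provisos₁₃CoPH F 2)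
    (hG : θ.ZhUnity F 2 ∧ θ.SlotsNondegenerate₁₃ F 2) (hθ : θ.Admissible F 2)
    (hB : B16.EndStatementBPrinted (datumOfRecord₁₃CoPH F 2 θ hP).C) (hE : DagBinding.EndpointExistence (datumOfRecord₁₃CoPH F 2 θ hP).C.toB12)
    (hlive : LiveSel F θ)
    (hrows : ¬ ForSmallCouplings (datumOfRecord₁₃CoPH F 2 θ hP) fun g₀ => ∀ os : List (ULoop F),
      PHolderD4 β (datumOfRecord₁₃CoPH F 2 θ hP) (rr F θ hP g₀ os) →
        ¬ ∃ (D ε m : ℝ) (v : ℕ → ℝ → (Σ K, SiteSeqKey F (0 + K)) → ℤ) (c₀ : ℕ → ℝ → ℝ),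
          0 < D ∧ ε < D / 4 ∧ 0 ≤ m ∧ m * (1 + exp (3 * D / 4)) ≤ 1 / 2 ∧
          ∃ᶠ K in atTop, ∃ t : ℝ, |t| ≤ 1 ∧ 0 < ∑ x ∈ classSet₁₃ θ 0 g₀ K, weightA₁₃ θ hP 0 g₀ os K t x ∧
            (∀ x ∈ classSet₁₃ θ 0 g₀ K,
              exp (c₀ K t + D * (v K t x : ℝ) - ε) * weightA₁₃ θ hP 0 g₀ os K t x ≤ weightB₁₃ θ hP 0 g₀ os K t x ∧
                weightB₁₃ θ hP 0 g₀ os K t x ≤ exp (c₀ K t + D * (v K t x : ℝ) + ε) * weightA₁₃ θ hP 0 g₀ os K t x) ∧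
            (∀ n : ℤ, ∑ x ∈ (classSet₁₃ θ 0 g₀ K).filter (fun x => v K t x = n), weightA₁₃ θ hP 0 g₀ os K t x ≤
              m * ∑ x ∈ classSet₁₃ θ 0 g₀ K, weightA₁₃ θ hP 0 g₀ os K t x)) :
    ¬ (KeyedRelWeight cr ∧ KeyedShellWeight cr ∧ KeyedCoreEdgeHolderD4 β cr rr) := by
  rintro ⟨h20, h21, h19⟩
  refine hrows ((h19 F θ hP hG hθ hB hE).mono fun g₀ hcore os hP4 hR => ?_)
  obtain ⟨D, ε, m, v, c₀, hD, hεD, hm, hm2, hfreq⟩ := hR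
  have hW := h20 F θ hP hG hθ g₀ os
  have hSh := h21 F θ hP hG hθ g₀ os
  have hC := hcore os hP4
  have e : cr F θ hP g₀ os = crOfRecord₁₃VAt 0 (jc F θ hP g₀ os) sh F θ hP g₀ os := hpin F θ hP g₀ os hlive
  rw [e] at hW hSh hC
  exact not_faces_crOfRecord₁₃VAt_of_quantised_antiConc 0 (jc F θ hP g₀ os) sh θ hP g₀ os hD hεD hm hm2 v c₀ hfreq ⟨hW, hSh, hC⟩

end Summit.QuantumFields.YangMills.BalabanUVNodes.N20QuantisedRatioNoRescueStubText

end
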